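import Summits.Ventures.WeilGRH.TwistedWindowMeasureGrowth
import HarnessLib

/-!
# GRH arm (rh-explicit, venture WeilGRH): THE TWISTED FORMAT-C GRAM FORMS ARE MULTIPLICITY CERTIFICATES —
  `μ{τ} · |û(½+iτ)|² ≤ 𝓔^χ_a(u) − M^χ_a‖u‖²` for every trigonometric window `u = Σ c_n χ_n`

Cell `rh-explicit`, WEIL TRACK (structure seat weil-3, gen9).  The `χ`-twin of `ZetaGramAtomsMatrix.lean`:
by `TwistedWindowMeasure.twistedWindowForm_sum_smul_chi_eq_integral` the twisted window form of a
trigonometric window `u = Σ_{n∈s} c_n χ_n` (complex coefficients) is `∫ ‖û(½+it)‖² dμ` for every positive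
`μ` representing `Q_χ` on `[-a, a]` (growth hypothesis automatic, `TwistedWindowMeasureGrowth`), hence

* **`atom_mul_norm_sq_le_twistedWindowForm`** (RH/GRH-free): `μ{τ} · ‖û(½+iτ)‖² ≤ 𝓔^χ_a(u) − M^χ_a‖u‖₂²`
  for every `τ` — the twisted Gram forms certified by the GRH-arm producers (weil-grh-1/2) bound the
  spectral mass at every height;
* **`zeroOrder_mul_norm_sq_le_twistedWindowForm`**: under `GRH(χ)` (`χ` primitive mod `q ≠ 1`),
  `ord_{s=½+iτ} L(s,χ) · ‖û(½+iτ)‖² ≤ 𝓔^χ_a(u) − M^χ_a‖u‖₂²` — a multiplicity certificate for every zero of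
  `L(s, χ)` from any twisted format-C Gram truncation.

No definitions, no named facts.
-/

set_option autoImplicit false

noncomputable section

open Complex Filter Set MeasureTheory
open scoped Real Topology ComplexConjugate

namespace Summit.Ventures.WeilGRH

open Literature.NumberTheory.LFunctions
open Literature.NumberTheory.LFunctions.Yoshida1992 (chi)
open Literature.NumberTheory.LFunctions.WeilBochner (charZeroHeightMeasure)

variable {q : ℕ} {a : ℝ}

/-- **THE TWISTED GRAM FORM BOUNDS THE ATOMS AT EVERY HEIGHT** (RH/GRH-free).  For `χ` mod `q ≠ 1`, `a > 0`,
every positive `μ` representing `Q_χ` on the tests of `[-a, a]`, every finite `s ⊆ ℤ`, coefficients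
`c : ℤ → ℂ` and `τ ∈ ℝ`, with `u = Σ_{n∈s} c_n χ_n`:
`μ{τ} · ‖û(½+iτ)‖² ≤ 𝓔^χ_a(u) − M^χ_a ‖u‖₂²`. -/
theorem atom_mul_norm_sq_le_twistedWindowForm (hq : q ≠ 1) (χ : DirichletCharacter ℂ q) (ha : 0 < a)
    {μ : Measure ℝ}
    (hμ : ∀ g : ℝ → ℂ, IsWeilTest g → tsupport g ⊆ Icc (-a) a →
      Integrable (fun t : ℝ ↦ ‖weilMellin g (1 / 2 + t * I)‖ ^ 2) μ ∧
        weilQuadraticChar χ g = ((∫ t, ‖weilMellin g (1 / 2 + t * I)‖ ^ 2 ∂μ : ℝ) : ℂ))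
    (s : Finset ℤ) (c : ℤ → ℂ) (τ : ℝ) :
    μ.real {τ} * ‖weilMellin (∑ n ∈ s, c n • chi a n) (1 / 2 + τ * I)‖ ^ 2 ≤
      weilDirichletEnergyChar χ a (∑ n ∈ s, c n • chi a n) -
        weilMarkovConstantChar χ a * ∫ x : ℝ, ‖(∑ n ∈ s, c n • chi a n) x‖ ^ 2 := by
  have hI := integrable_inv_one_add_sq_of_represents χ ha hμ
  obtain ⟨hint, heq⟩ := twistedWindowForm_sum_smul_chi_eq_integral hq χ ha hμ hI s c
  rw [heq]
  set u : ℝ → ℂ := ∑ n ∈ s, c n • chi a n with hu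
  have h0 := measure_singleton_lt_top_of_integrable hI τ
  set k : ℝ := ‖weilMellin u (1 / 2 + τ * I)‖ ^ 2 with hk
  have hind : Integrable (fun t : ℝ ↦ ({τ} : Set ℝ).indicator (fun _ ↦ k) t) μ :=
    (integrable_indicator_iff (measurableSet_singleton τ)).2 (integrableOn_const h0.ne)
  have hle : ∀ t : ℝ, ({τ} : Set ℝ).indicator (fun _ ↦ k) t ≤ ‖weilMellin u (1 / 2 + t * I)‖ ^ 2 := by
    intro t
    by_cases ht : t ∈ ({τ} : Set ℝ)
    · rw [indicator_of_mem ht, mem_singleton_iff.1 ht]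
    · rw [indicator_of_notMem ht]; positivity
  calc μ.real {τ} * k = ∫ t, ({τ} : Set ℝ).indicator (fun _ ↦ k) t ∂μ := by
        rw [integral_indicator_const _ (measurableSet_singleton τ), smul_eq_mul]
    _ ≤ ∫ t, ‖weilMellin u (1 / 2 + t * I)‖ ^ 2 ∂μ := integral_mono hind hint hle

/-- **`GRH(χ)` ⟹ EVERY TWISTED GRAM TRUNCATION IS A MULTIPLICITY CERTIFICATE**: for `χ` primitive mod
`q ≠ 1` with `GRH(χ)`, `a > 0`, finite `s ⊆ ℤ`, `c : ℤ → ℂ`, and every height `τ`, with `u = Σ c_n χ_n`: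
`ord_{s=½+iτ} L(s, χ) · ‖û(½+iτ)‖² ≤ 𝓔^χ_a(u) − M^χ_a ‖u‖₂²`. -/
theorem zeroOrder_mul_norm_sq_le_twistedWindowForm [NeZero q] {χ : DirichletCharacter ℂ q} (hq : q ≠ 1)
    (hprim : χ.IsPrimitive) (hGRH : χ.RiemannHypothesis) (ha : 0 < a) (s : Finset ℤ) (c : ℤ → ℂ) (τ : ℝ) :
    (DirichletDisc.zeroOrder χ (1 / 2 + τ * I) : ℝ) * ‖weilMellin (∑ n ∈ s, c n • chi a n) (1 / 2 + τ * I)‖ ^ 2 ≤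
      weilDirichletEnergyChar χ a (∑ n ∈ s, c n • chi a n) -
        weilMarkovConstantChar χ a * ∫ x : ℝ, ‖(∑ n ∈ s, c n • chi a n) x‖ ^ 2 := by
  have hχ : χ ≠ 1 := by
    rintro rfl
    rw [DirichletCharacter.isPrimitive_def, DirichletCharacter.conductor_one] at hprim
    exact hq hprim.symm
  have h := atom_mul_norm_sq_le_twistedWindowForm hq χ ha
    (fun g hg _ ↦ WeilBochner.weilQuadraticChar_eq_integral_of_riemannHypothesis hq hprim hGRH hg) s c τ
  rwa [measureReal_def, charZeroHeightMeasure_singleton_of_grh hχ hGRH, ENNReal.toReal_natCast] at h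

end Summit.Ventures.WeilGRH

end
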